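import Summits.MatrixMultiplication.MatrixMultiplication.Theses.SnSubsetDichotomy
import Summits.MatrixMultiplication.MatrixMultiplication.Theorems.SnSubsetDichotomyGlobalBranchStubFlatCaseUmv

/-!
# Bump-free sets are spectrally light (crux stmt-MatrixMultiplication-8303, line young-host-squeeze)

Crux `Summit.MatrixMultiplication.MatrixMultiplication.Theses.SnSubsetDichotomy.GlobalBranch`.  The crux's
hypothesis is BUMP-FREENESS: `|X ∩ U_{I→L}|·n^{(ℓ)} ≤ n^{(1/2+ε)ℓ}|X|` for all injective `ℓ`-tuples `I, L`,
`1 ≤ ℓ ≤ √n`, where `U_{I→L} = {σ : σ ∘ I = L}`.  The residual stubs of the lines `flat-tail-truncation` and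
`young-host-squeeze` are phrased through the SPECTRAL level-`ℓ` masses
`sM_ℓ(X) = |X|⁻² Σ_{μ ≠ (n), μ₁ = n-ℓ} Σ_{x,y∈X} Re χ^μ(x⁻¹y)` (first-row family) and `sT_ℓ(X)` (first-column
family).  This file makes the link quantitative: a bump bound with ratio `R` at level `ℓ` forces

* `Σ_{I,L} |X ∩ U_{I→L}|² ≤ R·|X|²` (`bumpFreeSpectral_sum_sq_le`: each term is `≤ (R|X|/n^{(ℓ)})·|X ∩ U_{I→L}|`
  and the umvirates with a fixed source `I` partition `X`);
* `sM_ℓ(X) ≤ R - 1` and `sT_ℓ(X) ≤ R` (`bumpFreeSpectral_specMass_le`, `bumpFreeSpectral_specMassT_le`), through the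
  landed umvirate Parseval bridges `flatCaseUmv_specMass_le` / `flatCaseUmv_specMassT_le`
  (`sM_ℓ ≤ Σ_{I,L}(|X ∩ U_{I→L}|/|X| - 1/n^{(ℓ)})² = (Σ_{I,L}|X ∩ U_{I→L}|² - |X|²)/|X|²`, and the signed version);
* hence, for every set `X` of a triple satisfying the crux's bump hypothesis at exponent `1/2+ε` and every level
  `1 ≤ ℓ ≤ ⌊√n⌋`: `sM_ℓ(X) ≤ n^{(1/2+ε)ℓ} - 1` and `sT_ℓ(X) ≤ n^{(1/2+ε)ℓ}` (`bumpFreeSpectral_of_bumpHyp`).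

Consequence for the promoted residual (coherence weight `Σ_{ℓ ≤ √n} n^{(ℓ)}(sM_ℓ(S)sM_ℓ(T)sM_ℓ(U) + twisted) > 1/2`):
at some common level `ℓ ≤ √n` EACH of the three sets has spectral mass `≥ n^{-(2+2ε)ℓ}/(8√n)`, far above the
random-like value `≈ n^{(ℓ)}/|X|`.
-/

set_option linter.dupNamespace false

open scoped BigOperators
open Finset
open Literature.NumberTheory.DiophantineGeometry (spechtCharacter)

namespace Summit.MatrixMultiplication.MatrixMultiplication.Theorems.GlobalBranch

section BumpFreeSpectral

variable {n ℓ : ℕ}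

/-- **Bump bound ⇒ L² bound on the umvirate profile**: if `|X ∩ U_{I→L}|·n^{(ℓ)} ≤ R·|X|` for all
injective `I, L` (`ℓ ≤ n`), then `Σ_{I,L} |X ∩ U_{I→L}|² ≤ R·|X|²`. [folklore] -/
theorem bumpFreeSpectral_sum_sq_le (hℓ : ℓ ≤ n) (X : Finset (Equiv.Perm (Fin n))) (R : ℝ)
    (hbf : ∀ I L : Fin ℓ ↪ Fin n,
      (((X.filter (fun σ => ∀ k, σ (I k) = L k)).card : ℕ) : ℝ) * (n.descFactorial ℓ : ℝ) ≤
        R * (X.card : ℝ)) :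
    ∑ I : Fin ℓ ↪ Fin n, ∑ L : Fin ℓ ↪ Fin n,
        (((X.filter (fun σ => ∀ k, σ (I k) = L k)).card : ℕ) : ℝ) ^ 2 ≤ R * (X.card : ℝ) ^ 2 := by
  -- (no classical: keep the Fin instances syntactic)
  have hdne : n.descFactorial ℓ ≠ 0 := by
    intro h0
    exact (not_lt.2 hℓ) (Nat.descFactorial_eq_zero_iff_lt.1 h0)
  have hd0 : (0 : ℝ) < (n.descFactorial ℓ : ℝ) := by exact_mod_cast Nat.pos_of_ne_zero hdne
  set d : ℝ := (n.descFactorial ℓ : ℝ) with hd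
  set c : ℝ := (X.card : ℝ) with hcdef
  set a : (Fin ℓ ↪ Fin n) → (Fin ℓ ↪ Fin n) → ℝ :=
    fun I L => (((X.filter (fun σ => ∀ k, σ (I k) = L k)).card : ℕ) : ℝ) with ha
  have ha0 : ∀ I L, 0 ≤ a I L := fun I L => by rw [ha]; positivity
  -- each term: a² ≤ a · (R c / d)
  have hterm : ∀ I L, a I L ^ 2 ≤ a I L * (R * c / d) := by
    intro I L
    have h1 : a I L ≤ R * c / d := by
      rw [le_div_iff₀ hd0]
      exact hbf I L
    rw [sq]
    exact mul_le_mul_of_nonneg_left h1 (ha0 I L)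
  -- row sums: Σ_L a I L = c
  have hrow : ∀ I : Fin ℓ ↪ Fin n, ∑ L : Fin ℓ ↪ Fin n, a I L = c := by
    intro I
    have h := flatCaseUmv_sum_sum_filter I X (fun _ => (1 : ℝ))
    simpa [ha] using h
  have hcard : ((((Finset.univ : Finset (Fin ℓ ↪ Fin n)).card : ℕ) : ℝ)) = d := by
    have h : (Finset.univ : Finset (Fin ℓ ↪ Fin n)).card = n.descFactorial ℓ := by
      rw [Finset.card_univ, Fintype.card_embedding_eq, Fintype.card_fin, Fintype.card_fin]
    rw [h]
  calc ∑ I : Fin ℓ ↪ Fin n, ∑ L : Fin ℓ ↪ Fin n, a I L ^ 2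
        ≤ ∑ I : Fin ℓ ↪ Fin n, ∑ L : Fin ℓ ↪ Fin n, a I L * (R * c / d) :=
          Finset.sum_le_sum fun I _ => Finset.sum_le_sum fun L _ => hterm I L
    _ = ∑ I : Fin ℓ ↪ Fin n, c * (R * c / d) := by
          refine Finset.sum_congr rfl fun I _ => ?_
          rw [← Finset.sum_mul, hrow I]
    _ = d * (c * (R * c / d)) := by
          rw [Finset.sum_const, nsmul_eq_mul, hcard]
    _ = R * c ^ 2 := by
          field_simp

/-- Signed version: `Σ_{I,L} (Σ_{σ ∈ X ∩ U_{I→L}} sgn σ)² ≤ R·|X|²` under the same bump bound. [folklore] -/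
theorem bumpFreeSpectral_sum_sgn_sq_le (hℓ : ℓ ≤ n) (X : Finset (Equiv.Perm (Fin n))) (R : ℝ)
    (hbf : ∀ I L : Fin ℓ ↪ Fin n,
      (((X.filter (fun σ => ∀ k, σ (I k) = L k)).card : ℕ) : ℝ) * (n.descFactorial ℓ : ℝ) ≤
        R * (X.card : ℝ)) :
    ∑ I : Fin ℓ ↪ Fin n, ∑ L : Fin ℓ ↪ Fin n,
        (∑ σ ∈ X.filter (fun σ => ∀ k, σ (I k) = L k), ((Equiv.Perm.sign σ : ℤ) : ℝ)) ^ 2 ≤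
      R * (X.card : ℝ) ^ 2 := by
  refine le_trans ?_ (bumpFreeSpectral_sum_sq_le hℓ X R hbf)
  refine Finset.sum_le_sum fun I _ => Finset.sum_le_sum fun L _ => ?_
  have habs : |∑ σ ∈ X.filter (fun σ => ∀ k, σ (I k) = L k), ((Equiv.Perm.sign σ : ℤ) : ℝ)| ≤
      (((X.filter (fun σ => ∀ k, σ (I k) = L k)).card : ℕ) : ℝ) := by
    refine (Finset.abs_sum_le_sum_abs _ _).trans ?_
    have h1 : ∀ σ ∈ X.filter (fun σ => ∀ k, σ (I k) = L k),
        |((Equiv.Perm.sign σ : ℤ) : ℝ)| ≤ 1 := by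
      intro σ _
      rcases Int.units_eq_one_or (Equiv.Perm.sign σ) with h | h <;> simp [h]
    refine (Finset.sum_le_sum h1).trans ?_
    simp
  have h0 : 0 ≤ (((X.filter (fun σ => ∀ k, σ (I k) = L k)).card : ℕ) : ℝ) := by positivity
  calc (∑ σ ∈ X.filter (fun σ => ∀ k, σ (I k) = L k), ((Equiv.Perm.sign σ : ℤ) : ℝ)) ^ 2
        = |∑ σ ∈ X.filter (fun σ => ∀ k, σ (I k) = L k), ((Equiv.Perm.sign σ : ℤ) : ℝ)| ^ 2 :=
          (sq_abs _).symm
    _ ≤ (((X.filter (fun σ => ∀ k, σ (I k) = L k)).card : ℕ) : ℝ) ^ 2 :=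
          pow_le_pow_left₀ (abs_nonneg _) habs 2

/-- **Bump bound ⇒ the first-row spectral mass is light**: under `|X ∩ U_{I→L}|·n^{(ℓ)} ≤ R|X|` for all
injective `I, L` (`ℓ ≤ n`, `X ≠ ∅`), `|X|⁻² Σ_{μ ≠ (n), μ₁ = n-ℓ} Σ_{x,y∈X} Re χ^μ(x⁻¹y) ≤ R - 1`.
[cite: EllisFriedgutPilpel2011, Thm. 7 (Young's rule lower bound, via the landed umvirate Parseval)] -/
theorem bumpFreeSpectral_specMass_le (hℓ : ℓ ≤ n) (X : Finset (Equiv.Perm (Fin n))) (hX : X.Nonempty)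
    (R : ℝ)
    (hbf : ∀ I L : Fin ℓ ↪ Fin n,
      (((X.filter (fun σ => ∀ k, σ (I k) = L k)).card : ℕ) : ℝ) * (n.descFactorial ℓ : ℝ) ≤
        R * (X.card : ℝ)) :
    (∑ μ ∈ univ.filter (fun μ : Nat.Partition n =>
        μ ≠ Nat.Partition.indiscrete n ∧ μ.parts.sup = n - ℓ),
      ∑ x ∈ X, ∑ y ∈ X, (spechtCharacter ℂ μ (x⁻¹ * y)).re) / ((X.card : ℝ) ^ 2) ≤ R - 1 := by
  -- (no classical: keep the Fin instances syntactic)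
  have hc : (X.card : ℝ) ≠ 0 := by exact_mod_cast hX.card_pos.ne'
  have hcpos : (0 : ℝ) < (X.card : ℝ) ^ 2 := by positivity
  have hbridge := flatCaseUmv_specMass_le hℓ X
  refine hbridge.trans ?_
  -- c²·Σ(a/c - 1/d)² = Σ a² - c²
  have hdne : n.descFactorial ℓ ≠ 0 := by
    intro h0
    exact (not_lt.2 hℓ) (Nat.descFactorial_eq_zero_iff_lt.1 h0)
  have hd0 : (n.descFactorial ℓ : ℝ) ≠ 0 := by exact_mod_cast hdne
  have hcard : ((((Finset.univ : Finset (Fin ℓ ↪ Fin n)).card : ℕ) : ℝ)) = (n.descFactorial ℓ : ℝ) := by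
    have h : (Finset.univ : Finset (Fin ℓ ↪ Fin n)).card = n.descFactorial ℓ := by
      rw [Finset.card_univ, Fintype.card_embedding_eq, Fintype.card_fin, Fintype.card_fin]
    rw [h]
  set a : (Fin ℓ ↪ Fin n) → (Fin ℓ ↪ Fin n) → ℝ :=
    fun I L => (((X.filter (fun σ => ∀ k, σ (I k) = L k)).card : ℕ) : ℝ) with ha
  have hrow : ∀ I : Fin ℓ ↪ Fin n, ∑ L : Fin ℓ ↪ Fin n, a I L = (X.card : ℝ) := by
    intro I
    have h := flatCaseUmv_sum_sum_filter I X (fun _ => (1 : ℝ))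
    simpa [ha] using h
  have hexp := flatCaseUmv_sq_expand a (X.card : ℝ) (X.card : ℝ) (n.descFactorial ℓ : ℝ) hc hd0 hcard
    hrow
  have hone : (X.card : ℝ) / (X.card : ℝ) / (n.descFactorial ℓ : ℝ) = 1 / (n.descFactorial ℓ : ℝ) := by
    rw [div_self hc]
  rw [hone] at hexp
  have hsq := bumpFreeSpectral_sum_sq_le hℓ X R hbf
  -- Σ(a/c - 1/d)² = (Σ a² - c²)/c² ≤ (R c² - c²)/c² = R - 1
  have key : (X.card : ℝ) ^ 2 * ∑ I : Fin ℓ ↪ Fin n, ∑ L : Fin ℓ ↪ Fin n,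
      (a I L / (X.card : ℝ) - 1 / (n.descFactorial ℓ : ℝ)) ^ 2 ≤ (X.card : ℝ) ^ 2 * (R - 1) := by
    rw [hexp]
    have : ∑ I : Fin ℓ ↪ Fin n, ∑ L : Fin ℓ ↪ Fin n, a I L ^ 2 ≤ R * (X.card : ℝ) ^ 2 := hsq
    nlinarith
  exact le_of_mul_le_mul_left key hcpos

/-- **Bump bound ⇒ the first-column (sign-twisted) spectral mass is light**: under the same bump bound
(`1 ≤ ℓ ≤ n`, `X ≠ ∅`), `|X|⁻² Σ_{μ ≠ (n), μ₁' = n-ℓ} Σ_{x,y∈X} Re χ^μ(x⁻¹y) ≤ R`.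
[cite: EllisFriedgutPilpel2011, Thm. 7] -/
theorem bumpFreeSpectral_specMassT_le (hn : 1 ≤ n) (hℓ1 : 1 ≤ ℓ) (hℓ : ℓ ≤ n)
    (X : Finset (Equiv.Perm (Fin n))) (hX : X.Nonempty) (R : ℝ)
    (hbf : ∀ I L : Fin ℓ ↪ Fin n,
      (((X.filter (fun σ => ∀ k, σ (I k) = L k)).card : ℕ) : ℝ) * (n.descFactorial ℓ : ℝ) ≤
        R * (X.card : ℝ)) :
    (∑ μ ∈ univ.filter (fun μ : Nat.Partition n =>
        μ ≠ Nat.Partition.indiscrete n ∧ Multiset.card μ.parts = n - ℓ),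
      ∑ x ∈ X, ∑ y ∈ X, (spechtCharacter ℂ μ (x⁻¹ * y)).re) / ((X.card : ℝ) ^ 2) ≤ R := by
  -- (no classical: keep the Fin instances syntactic)
  have hc : (X.card : ℝ) ≠ 0 := by exact_mod_cast hX.card_pos.ne'
  have hcpos : (0 : ℝ) < (X.card : ℝ) ^ 2 := by positivity
  have hbridge := flatCaseUmv_specMassT_le hn hℓ1 hℓ X
  refine hbridge.trans ?_
  have hdne : n.descFactorial ℓ ≠ 0 := by
    intro h0
    exact (not_lt.2 hℓ) (Nat.descFactorial_eq_zero_iff_lt.1 h0)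
  have hd0 : (n.descFactorial ℓ : ℝ) ≠ 0 := by exact_mod_cast hdne
  have hcard : ((((Finset.univ : Finset (Fin ℓ ↪ Fin n)).card : ℕ) : ℝ)) = (n.descFactorial ℓ : ℝ) := by
    have h : (Finset.univ : Finset (Fin ℓ ↪ Fin n)).card = n.descFactorial ℓ := by
      rw [Finset.card_univ, Fintype.card_embedding_eq, Fintype.card_fin, Fintype.card_fin]
    rw [h]
  set b : (Fin ℓ ↪ Fin n) → (Fin ℓ ↪ Fin n) → ℝ :=
    fun I L => ∑ σ ∈ X.filter (fun σ => ∀ k, σ (I k) = L k), ((Equiv.Perm.sign σ : ℤ) : ℝ) with hb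
  set s : ℝ := ∑ σ ∈ X, ((Equiv.Perm.sign σ : ℤ) : ℝ) with hs
  have hrow : ∀ I : Fin ℓ ↪ Fin n, ∑ L : Fin ℓ ↪ Fin n, b I L = s :=
    fun I => flatCaseUmv_sum_sum_filter I X (fun σ => ((Equiv.Perm.sign σ : ℤ) : ℝ))
  have hexp := flatCaseUmv_sq_expand b (X.card : ℝ) s (n.descFactorial ℓ : ℝ) hc hd0 hcard hrow
  have hsq := bumpFreeSpectral_sum_sgn_sq_le hℓ X R hbf
  have key : (X.card : ℝ) ^ 2 * ∑ I : Fin ℓ ↪ Fin n, ∑ L : Fin ℓ ↪ Fin n,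
      (b I L / (X.card : ℝ) - s / (X.card : ℝ) / (n.descFactorial ℓ : ℝ)) ^ 2 ≤ (X.card : ℝ) ^ 2 * R := by
    rw [hexp]
    have : ∑ I : Fin ℓ ↪ Fin n, ∑ L : Fin ℓ ↪ Fin n, b I L ^ 2 ≤ R * (X.card : ℝ) ^ 2 := hsq
    nlinarith [sq_nonneg s]
  exact le_of_mul_le_mul_left key hcpos

/-- **The crux's bump hypothesis makes every set of the triple spectrally light at every level
`1 ≤ ℓ ≤ ⌊√n⌋`**: if `S, T, U` satisfy the bump hypothesis of `GlobalBranch` at exponent `1/2+ε` (levels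
`t ≤ √n`, injective `t`-tuples), then for `X ∈ {S,T,U}` non-empty and `1 ≤ ℓ ≤ ⌊√n⌋`:
`sM_ℓ(X) ≤ n^{(1/2+ε)ℓ} - 1` and `sT_ℓ(X) ≤ n^{(1/2+ε)ℓ}`. [cite: EllisFriedgutPilpel2011, Thm. 7] -/
theorem bumpFreeSpectral_of_bumpHyp (ε : ℝ) (S T U X : Finset (Equiv.Perm (Fin n)))
    (hXm : X = S ∨ X = T ∨ X = U) (hX : X.Nonempty)
    (hbf : ∀ X : Finset (Equiv.Perm (Fin n)), (X = S ∨ X = T ∨ X = U) → ∀ t : ℕ, 1 ≤ t →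
      (t : ℝ) ≤ Real.sqrt (n : ℝ) → ∀ I L : Fin t → Fin n, Function.Injective I →
      Function.Injective L →
      ((X.filter (fun σ => ∀ k, σ (I k) = L k)).card : ℝ) * (n.descFactorial t : ℝ) ≤
        (n : ℝ) ^ ((1 / 2 + ε) * t) * (X.card : ℝ))
    (hℓ1 : 1 ≤ ℓ) (hℓ : ℓ ≤ Nat.sqrt n) :
    (∑ μ ∈ univ.filter (fun μ : Nat.Partition n =>
        μ ≠ Nat.Partition.indiscrete n ∧ μ.parts.sup = n - ℓ),
      ∑ x ∈ X, ∑ y ∈ X, (spechtCharacter ℂ μ (x⁻¹ * y)).re) / ((X.card : ℝ) ^ 2) ≤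
        (n : ℝ) ^ ((1 / 2 + ε) * ℓ) - 1 ∧
    (∑ μ ∈ univ.filter (fun μ : Nat.Partition n =>
        μ ≠ Nat.Partition.indiscrete n ∧ Multiset.card μ.parts = n - ℓ),
      ∑ x ∈ X, ∑ y ∈ X, (spechtCharacter ℂ μ (x⁻¹ * y)).re) / ((X.card : ℝ) ^ 2) ≤
        (n : ℝ) ^ ((1 / 2 + ε) * ℓ) := by
  have hℓn : ℓ ≤ n := hℓ.trans (Nat.sqrt_le_self n)
  have hn : 1 ≤ n := hℓ1.trans hℓn
  have hℓr : (ℓ : ℝ) ≤ Real.sqrt (n : ℝ) :=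
    le_trans (by exact_mod_cast hℓ) (Real.nat_sqrt_le_real_sqrt (a := n))
  have hbf' : ∀ I L : Fin ℓ ↪ Fin n,
      (((X.filter (fun σ => ∀ k, σ (I k) = L k)).card : ℕ) : ℝ) * (n.descFactorial ℓ : ℝ) ≤
        (n : ℝ) ^ ((1 / 2 + ε) * ℓ) * (X.card : ℝ) :=
    fun I L => hbf X hXm ℓ hℓ1 hℓr I L I.injective L.injective
  exact ⟨bumpFreeSpectral_specMass_le hℓn X hX _ hbf',
    bumpFreeSpectral_specMassT_le hn hℓ1 hℓn X hX _ hbf'⟩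

end BumpFreeSpectral

end Summit.MatrixMultiplication.MatrixMultiplication.Theorems.GlobalBranch
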